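import Literature.NumberTheory.EllipticCurves.BSDSelmerSmithCasesProofs
import Literature.NumberTheory.EllipticCurves.IsogenyTwoPowerQuotientProofs
import Literature.NumberTheory.EllipticCurves.IsogenyFactorProofs
import Literature.NumberTheory.EllipticCurves.FermatQuarticDescent
import HarnessLib

/-!
# The balanced neighbours of a Case V curve are in Case IV (Smith, arXiv:2503.17619, proof of
# Thm. 1.7: the input "[Chil21]")

A `…Proofs` companion (theorems only, no new definitions, no named facts) of
`BSDSelmerSmithCases` / `BSDSelmerSmithCasesProofs` and of
`Literature.NumberTheory.EllipticCurves.BSDSelmer` §bsd.S34 (`smith_selmerCorank_density` =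
A. Smith, *The Birch and Swinnerton-Dyer conjecture implies Goldfeld's conjecture*,
arXiv:2503.17619 (2025), Thm. 1.1).

In the proof of Thm. 1.7 (§1.2) Smith writes: *"Take `φ' : E_0 → E` to be the dual isogeny to
`φ`; it is also a balanced isogeny. By assumption if `E` is in Case IV and by [Chil21] if `E` is
in Case V, we find that `E_0` is in Case IV"*, and in §3: *"we reproduce in Figure 1 the five
forms that the `2`-isogeny graph of an elliptic curve over `ℚ` can take, as recorded in [Chil21] …
`E(ℚ)[2] = (ℤ/2ℤ)²` if and only if the vertex corresponding to `E` has degree `3`. So we see that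
`E` is in Case V only if it corresponds to the central node of the final graph, and that the other
nodes of degree `3` in this graph are in Case IV."* Here [Chil21] = G. Chiloyan,
Á. Lozano-Robledo, *A classification of isogeny-torsion graphs of `ℚ`-isogeny classes of elliptic
curves*, Trans. London Math. Soc. 8 (2021), 1–34 (the `2`-isogeny graphs are `T₄`, `T₆`, `T₈`).

The assembly `smith_selmerCorank_density_of_printed_inputs` (`BSDSelmerSmithCasesProofs`) took
this input as the hypothesis `hChil : smithCaseV E → φ.IsBalanced → smithCaseIV E₁`. This file
**proves** it (`smithCaseIV_of_smithCaseV_of_isBalanced`) and restates the assembly without it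
(`smith_selmerCorank_density_of_printed_inputs'`). The statement needed is much weaker than the
classification of [Chil21] and has a classical elementary proof, which we give: it comes down to
Fermat's theorem that `x⁴ - y⁴ = z²` has no non-trivial solutions (tree
`fermat_fourth_pow_sub_fourth_pow_ne_sq`, `FermatQuarticDescent`; i.e. `y² = x³ - x` has rank `0`,
equivalently the `2`-isogeny graph of a rational isogeny class has no path of four vertices of
degree `3`).

## The argument

* §A (over `ℚ`) Fermat: for `v ≠ 0`, `v⁴ ≠ 1`, neither `v⁴ - 1` nor `1 - v⁴` is a square; hence
  for `q ∉ {0, ±1}` not both "`±q` is a square" and "`±(1 - q²)` is a square"; hence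
  (`caseV_algebraic_core`) for `r, s ≠ 0` distinct and `α + β = -2(r + s)`, `αβ = (r - s)²` it is
  impossible that one of `r(r - s)`, `s(s - r)` and one of `α(α - β)`, `β(β - α)` are squares
  (put `t = (α - β)/4`, `t² = rs`, `q = t/r`).
* §B–§C (any field, `char ≠ 2`; `K` perfect where Galois descent is used) On
  `E : y² = x³ + ax² + bx` (the tree's two-torsion normal form, `IsogenyTwoTorsionProofs`) the
  points of order `2` are the `(x, 0)`; `K(E[2]) = K` (`ker ρ̄_{E,2} = Γ_K`) forces
  `x² + ax + b` to split over `K` (a root gives a `Γ_K`-fixed `2`-torsion point, rational by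
  `K̄^{Γ_K} = K`); over `ℚ`, `#E(ℚ)[2] = 4 ⟹ ℚ(E[2]) = ℚ`, and a Case V curve has `#E(ℚ)[2] = 4`.
* §D The explicit quotient `g : E → B = E/⟨(x₀, 0)⟩`, `f : B → E`, `ker g = {O, (x₀,0)}`,
  `fg = gf = [2]`, with `B` Silverman's `Y² = X³ - 2a'X² + (a'² - 4b')X` for the shifted model
  (`a' = a + 3x₀`, `b' = b + 2ax₀ + 3x₀²`) — the tree's `exists_isogeny_ker_eq_pair`
  (`IsogenyTwoPowerQuotientProofs`, Silverman III.4.5, III.4.12) with the codomain kept explicit.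
* §E Uniqueness of the quotient (Silverman III.4.11, via the tree's
  `Isogeny.exists_eq_comp_zsmul_of_geomTorsion_le_ker`): an isogeny `φ` with `ker φ = ker g`
  factors as `λ ∘ g` with `λ : B → E₁` bijective on `K̄`-points; kernels of degree-`2` isogenies;
  transport along changes of model of the source.
* §H The core: `K(E₁[2]) = K` passes to `B` along `λ`, so `b'` … precisely
  `isSquare_of_isogeny_ker_root`: a degree-`2` kernel `{O, (x₀, 0)}` on `E` with target having
  full rational `2`-torsion makes `b + 2ax₀ + 3x₀²` a square; `caseV_core` and
  `isSquare_or_isSquare_of_second_kernel` turn the configuration "Case V curve `E`, balanced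
  `φ : E → E₁`, balanced `ψ` on `E₁` with `ker ψ ≠ φ(E[2])`" on the adapted model
  `E : y² = x(x - r)(x - s)` (`exists_model_of_two_torsion`) into the squares excluded by §A.
* §I `smithCaseIV_of_smithCaseV_of_isBalanced`, `not_smithCaseV_of_isBalanced`,
  `smith_selmerCorank_density_of_printed_inputs'`.

## References

* [arXiv250317619] A. Smith, arXiv:2503.17619 (2025): §1.1 Def. 1.6, §1.2 (proof of Thm. 1.7),
  §3 (Figure 1 and the sentence following it).
* [ChiloyanLozanorobledo2021] (= [Chil21]) G. Chiloyan, Á. Lozano-Robledo, *A classification of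
  isogeny-torsion graphs of `ℚ`-isogeny classes of elliptic curves*, Trans. London Math. Soc. 8
  (2021), 1–34 (doi:10.1112/tlm3.12024, arXiv:2001.05616), Thm. 1.2 (26 types of isogeny graphs;
  the `T_k` graphs are `T₄, T₆, T₈`), proved in §6 from Kenku's theorem.
* [SilvermanAEC2009] J. H. Silverman, *AEC*, 2nd ed., III.1 (Table 3.1), III.4 Example 4.5,
  Cor. III.4.11, Prop. III.4.12, Thm. III.6.1–6.2, III.§7, VIII.§1, X.4.9.
* [Koshy2001] T. Koshy, *Elementary Number Theory with Applications* (2001), Thm 13.3 (Fermat,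
  `x⁴ - y⁴ = z²`).
-/

noncomputable section

open scoped Classical

universe u

namespace Literature.NumberTheory.EllipticCurves

/-! ## §A Fermat over `ℚ` and the algebraic core -/

/-- **Fermat's `x⁴ − y⁴ ≠ z²` over `ℚ`**: for a rational `v ≠ 0` with `v⁴ ≠ 1`, neither
`v⁴ − 1` nor `1 − v⁴` is the square of a rational number (clear denominators and apply the tree's
`fermat_fourth_pow_sub_fourth_pow_ne_sq`, Koshy Thm 13.3). Equivalently: the curves
`w² = v⁴ − 1`, `w² = 1 − v⁴` have only the rational points with `vw = 0` (Fermat; "`1` is not a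
congruent number"). [cite: Koshy2001, Thm 13.3] -/
theorem not_isSquare_pow_four_sub_one {v : ℚ} (hv : v ≠ 0) (hv1 : v ^ 4 ≠ 1) :
    ¬ IsSquare (v ^ 4 - 1) ∧ ¬ IsSquare (1 - v ^ 4) := by
  -- write `v = m / n`, and a putative square root `w = c / e`
  have hv' : v = v.num / v.den := (Rat.num_div_den v).symm
  set m : ℤ := v.num with hm
  set n : ℕ := v.den with hn
  have hn0 : (n : ℚ) ≠ 0 := by exact_mod_cast v.den_nz
  have hm0 : (m : ℚ) ≠ 0 := by
    intro h
    apply hv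
    rw [hv', h, zero_div]
  constructor
  · rintro ⟨w, hw⟩
    have hw' : w = w.num / w.den := (Rat.num_div_den w).symm
    set c : ℤ := w.num with hc
    set e : ℕ := w.den with he
    have he0 : (e : ℚ) ≠ 0 := by exact_mod_cast w.den_nz
    have hw0 : w ≠ 0 := by
      rintro rfl
      apply hv1
      linear_combination hw
    have hc0 : (c : ℚ) ≠ 0 := by
      intro h
      apply hw0
      rw [hw', h, zero_div]
    -- `(m e)⁴ − (n e)⁴ = (c e n²)²`
    have key : ((m : ℚ) * e) ^ 4 - ((n : ℚ) * e) ^ 4 = ((c : ℚ) * e * (n : ℚ) ^ 2) ^ 2 := by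
      rw [hv', hw'] at hw
      field_simp at hw
      linear_combination (e : ℚ) ^ 2 * hw
    have keyZ : ((m * e : ℤ)) ^ 4 - ((n : ℤ) * e) ^ 4 = (c * e * (n : ℤ) ^ 2) ^ 2 := by
      exact_mod_cast key
    refine fermat_fourth_pow_sub_fourth_pow_ne_sq ?_ ?_ keyZ
    · exact_mod_cast mul_ne_zero hn0 he0
    · exact_mod_cast mul_ne_zero (mul_ne_zero hc0 he0) (pow_ne_zero 2 hn0)
  · rintro ⟨w, hw⟩
    have hw' : w = w.num / w.den := (Rat.num_div_den w).symm
    set c : ℤ := w.num with hc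
    set e : ℕ := w.den with he
    have he0 : (e : ℚ) ≠ 0 := by exact_mod_cast w.den_nz
    have hw0 : w ≠ 0 := by
      rintro rfl
      apply hv1
      linear_combination (-1 : ℚ) * hw
    have hc0 : (c : ℚ) ≠ 0 := by
      intro h
      apply hw0
      rw [hw', h, zero_div]
    -- `(n e)⁴ − (m e)⁴ = (c e n²)²`
    have key : ((n : ℚ) * e) ^ 4 - ((m : ℚ) * e) ^ 4 = ((c : ℚ) * e * (n : ℚ) ^ 2) ^ 2 := by
      rw [hv', hw'] at hw
      field_simp at hw
      linear_combination (e : ℚ) ^ 2 * hw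
    have keyZ : ((n : ℤ) * e) ^ 4 - ((m * e : ℤ)) ^ 4 = (c * e * (n : ℤ) ^ 2) ^ 2 := by
      exact_mod_cast key
    refine fermat_fourth_pow_sub_fourth_pow_ne_sq ?_ ?_ keyZ
    · exact_mod_cast mul_ne_zero hm0 he0
    · exact_mod_cast mul_ne_zero (mul_ne_zero hc0 he0) (pow_ne_zero 2 hn0)

/-- **The Diophantine core.** For a rational `q ∉ {0, 1, -1}` it is impossible that `±q` is a
square and `±(1 − q²)` is a square: writing `q = ±v²`, this is Fermat's `v⁴ ∓ 1 ≠ w²`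
(`not_isSquare_pow_four_sub_one`). [cite: Koshy2001, Thm 13.3] -/
theorem not_isSquare_and_isSquare_one_sub_sq {q : ℚ} (hq0 : q ≠ 0) (hq1 : q ≠ 1) (hq1' : q ≠ -1)
    (h₁ : IsSquare q ∨ IsSquare (-q)) (h₂ : IsSquare (1 - q ^ 2) ∨ IsSquare (q ^ 2 - 1)) :
    False := by
  -- `q = ± v²`, `q² = v⁴`
  obtain ⟨v, hv⟩ : ∃ v : ℚ, q ^ 2 = v ^ 4 ∧ v ≠ 0 := by
    rcases h₁ with ⟨v, hv⟩ | ⟨v, hv⟩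
    · refine ⟨v, by rw [hv]; ring, ?_⟩
      rintro rfl
      exact hq0 (by simpa using hv)
    · refine ⟨v, by linear_combination (-q + v * v) * hv, ?_⟩
      rintro rfl
      exact hq0 (by simpa using hv)
  have hv1 : v ^ 4 ≠ 1 := by
    intro h
    rw [h] at hv
    have : (q - 1) * (q + 1) = 0 := by linear_combination hv.1
    rcases mul_eq_zero.mp this with h' | h'
    · exact hq1 (by linear_combination h')
    · exact hq1' (by linear_combination h')
  obtain ⟨hA, hB⟩ := not_isSquare_pow_four_sub_one hv.2 hv1
  rcases h₂ with h | h
  · exact hB (by rwa [← hv.1])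
  · exact hA (by rwa [← hv.1])

/-- **The algebraic identity behind "Case V neighbours are Case IV".** Let `r, s ∈ ℚ` be
distinct and nonzero (the curve `E : y² = x(x − r)(x − s)`), and let `α, β ∈ ℚ` satisfy
`α + β = −2(r + s)`, `αβ = (r − s)²` (the curve `E/⟨(0,0)⟩ : Y² = X(X − α)(X − β)` has full
rational `2`-torsion). Then it is impossible that simultaneously one of `r(r − s)`, `s(s − r)` is a
square (a second `2`-quotient of `E` has full rational `2`-torsion: `E` is in Smith's Case V) and
one of `α(α − β)`, `β(β − α)` is a square (a second `2`-quotient of `E/⟨(0,0)⟩` has full rational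
`2`-torsion). With `t = (α − β)/4` one has `t² = rs`; putting `q = t/r`: `s = rq²`,
`r(r − s) = r²(1 − q²)`, `s(s − r) = (rq)²(q² − 1)`, `α(α − β) = −q(2r(1 − q))²`,
`β(β − α) = q(2r(1 + q))²`, and Fermat's theorem applies (`not_isSquare_and_isSquare_one_sub_sq`;
square factors are removed with the tree's `WeierstrassCurve.isSquare_mul_sq_iff`).
[cite: Koshy2001, Thm 13.3] -/
theorem caseV_algebraic_core {r s α β : ℚ} (hr : r ≠ 0) (hs : s ≠ 0) (hrs : r ≠ s)
    (hsum : α + β = -2 * (r + s)) (hprod : α * β = (r - s) ^ 2)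
    (hV : IsSquare (r * (r - s)) ∨ IsSquare (s * (s - r)))
    (hS : IsSquare (α * (α - β)) ∨ IsSquare (β * (β - α))) : False := by
  set t : ℚ := (α - β) / 4 with ht
  have hα : α = -(r + s) + 2 * t := by rw [ht]; linear_combination hsum / 2
  have hβ : β = -(r + s) - 2 * t := by rw [ht]; linear_combination hsum / 2
  have hts : t ^ 2 = r * s := by
    rw [ht]
    linear_combination ((α + β - 2 * (r + s)) * hsum - 4 * hprod) / 16
  set q : ℚ := t / r with hq
  have htq : t = r * q := by rw [hq]; field_simp
  have hsq : s = r * q ^ 2 := by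
    have : r * (s - r * q ^ 2) = 0 := by linear_combination (-1 : ℚ) * hts + (t + r * q) * htq
    rcases mul_eq_zero.mp this with h | h
    · exact absurd h hr
    · linear_combination h
  have hq0 : q ≠ 0 := by
    rintro h0
    rw [h0] at hsq
    exact hs (by simpa using hsq)
  have hq1 : q ≠ 1 := by
    rintro h1
    rw [h1] at hsq
    exact hrs (by linear_combination (-1 : ℚ) * hsq)
  have hq1' : q ≠ -1 := by
    rintro h1
    rw [h1] at hsq
    exact hrs (by linear_combination (-1 : ℚ) * hsq)
  have h2r : (2 : ℚ) * r * (1 - q) ≠ 0 :=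
    mul_ne_zero (mul_ne_zero two_ne_zero hr) (sub_ne_zero.mpr (Ne.symm hq1))
  have h2r' : (2 : ℚ) * r * (1 + q) ≠ 0 := by
    refine mul_ne_zero (mul_ne_zero two_ne_zero hr) ?_
    intro h
    exact hq1' (by linear_combination h)
  have hrq : r * q ≠ 0 := mul_ne_zero hr hq0
  refine not_isSquare_and_isSquare_one_sub_sq hq0 hq1 hq1' ?_ ?_
  · rcases hS with h | h
    · right
      have e : α * (α - β) = (2 * r * (1 - q)) ^ 2 * -q := by rw [hα, hβ, htq, hsq]; ring
      rw [e] at h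
      exact (WeierstrassCurve.isSquare_mul_sq_iff h2r _).mp h
    · left
      have e : β * (β - α) = (2 * r * (1 + q)) ^ 2 * q := by rw [hα, hβ, htq, hsq]; ring
      rw [e] at h
      exact (WeierstrassCurve.isSquare_mul_sq_iff h2r' _).mp h
  · rcases hV with h | h
    · left
      have e : r * (r - s) = r ^ 2 * (1 - q ^ 2) := by rw [hsq]; ring
      rw [e] at h
      exact (WeierstrassCurve.isSquare_mul_sq_iff hr _).mp h
    · right
      have e : s * (s - r) = (r * q) ^ 2 * (q ^ 2 - 1) := by rw [hsq]; ring
      rw [e] at h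
      exact (WeierstrassCurve.isSquare_mul_sq_iff hrq _).mp h


end Literature.NumberTheory.EllipticCurves

namespace WeierstrassCurve

open Literature.NumberTheory.EllipticCurves

/-! ## §B Points of order `2` on `y² = x³ + ax² + bx` -/

section TwoTorsionNF

variable {F : Type*} [Field F] (V : WeierstrassCurve F) [V.IsTwoTorsionNF]

/-- On `y² = x³ + ax² + bx` over a field with `2 ≠ 0`, an affine point `(x, y)` satisfies
`2(x, y) = O` iff `y = 0` (`-(x, y) = (x, -y)`). Silverman, *AEC*, III.2.3 and X.4.9. [folklore] -/
theorem two_nsmul_some_eq_zero_iff (h2 : (2 : F) ≠ 0) {x y : F} (h : V.toAffine.Nonsingular x y) :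
    (2 : ℕ) • (Affine.Point.some x y h) = 0 ↔ y = 0 := by
  rw [two_nsmul]
  constructor
  · intro hP
    have hy : y = V.toAffine.negY x y := by
      by_contra hy
      rw [Affine.Point.add_self_of_Y_ne hy] at hP
      exact Affine.Point.some_ne_zero _ hP
    rw [negY_of_isTwoTorsionNF] at hy
    have h2y : (2 : F) * y = 0 := by linear_combination hy
    exact (mul_eq_zero.mp h2y).resolve_left h2
  · intro hy
    subst hy
    have hneg : -(Affine.Point.some x 0 h) = Affine.Point.some x 0 h := by
      rw [Affine.Point.neg_some]
      obtain ⟨h', e⟩ := some_eq_some_of_eq (V := V) ((Affine.nonsingular_neg _ _).mpr h) rfl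
        (show V.toAffine.negY x 0 = 0 by rw [negY_of_isTwoTorsionNF, neg_zero])
      exact e
    exact add_eq_zero_iff_eq_neg.mpr hneg.symm

/-- On `y² = x(x - r)(x - s)` (`a₂ = -(r + s)`, `a₄ = rs`), a point `P` with `2P = O` is `O` or
one of `(0, 0)`, `(r, 0)`, `(s, 0)`. Silverman, *AEC*, III.2.3, X.4.9. [folklore] -/
theorem eq_of_two_nsmul_eq_zero (h2 : (2 : F) ≠ 0) {r s : F} (h₂ : V.a₂ = -(r + s))
    (h₄ : V.a₄ = r * s) {P : V.toAffine.Point} (hP : (2 : ℕ) • P = 0) :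
    P = 0 ∨ ∃ (x : F) (hx : V.toAffine.Nonsingular x 0), P = Affine.Point.some x 0 hx ∧
      (x = 0 ∨ x = r ∨ x = s) := by
  rcases P with _ | ⟨x, y, h⟩
  · exact Or.inl rfl
  · have hy : y = 0 := (two_nsmul_some_eq_zero_iff V h2 h).mp hP
    subst hy
    refine Or.inr ⟨x, h, rfl, ?_⟩
    have heq := rel_of_nonsingular V h
    rw [h₂, h₄] at heq
    have hprod : x * (x - r) * (x - s) = 0 := by linear_combination -heq
    rcases mul_eq_zero.mp hprod with h' | h'
    · rcases mul_eq_zero.mp h' with h'' | h''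
      · exact Or.inl h''
      · exact Or.inr (Or.inl (sub_eq_zero.mp h''))
    · exact Or.inr (Or.inr (sub_eq_zero.mp h'))

/-- On an elliptic `y² = x³ + ax² + bx`, a root `x₀` of `x³ + ax² + bx` gives the nonsingular point
`(x₀, 0)` (of order `2`). [folklore] -/
theorem nonsingular_of_root [V.IsElliptic] {x₀ : F} (hx₀ : x₀ ^ 3 + V.a₂ * x₀ ^ 2 + V.a₄ * x₀ = 0) :
    V.toAffine.Nonsingular x₀ 0 :=
  (Affine.equation_iff_nonsingular (W := V)).mp
    ((equation_iff_of_isTwoTorsionNF V x₀ 0).mpr (by linear_combination -hx₀))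

end TwoTorsionNF

/-! ## §C `K(E[2]) = K`: curves with full rational `2`-torsion -/

section FullTwoTorsion

variable {K : Type u} [Field K]

/-- `σ ∈ ker ρ̄_{E,n}` iff `σ` fixes every `P ∈ E(K̄)` with `nP = O` (unfolding of
`galoisRepTorsion`). [folklore] -/
theorem mem_ker_galoisRepTorsion_iff' (W : WeierstrassCurve K) (n : ℤ)
    (σ : Field.absoluteGaloisGroup K) :
    σ ∈ (W.galoisRepTorsion n).ker ↔ ∀ P : W.geomPoints, n • P = 0 → σ • P = P := by
  rw [MonoidHom.mem_ker]
  constructor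
  · intro h P hP
    have h1 : σ • (⟨P, (Submodule.mem_torsionBy_iff _ _).mpr hP⟩ : geomTorsion W n) =
        ⟨P, (Submodule.mem_torsionBy_iff _ _).mpr hP⟩ := by
      rw [← galoisRepTorsion_apply, h]
      rfl
    exact congrArg Subtype.val h1
  · intro h
    refine Multiplicative.toAdd.injective (AddEquiv.ext fun P ↦ ?_)
    rw [galoisRepTorsion_apply]
    exact Subtype.ext (h P ((Submodule.mem_torsionBy_iff _ _).mp P.2))

/-- `ker ρ̄_{E,n} = Γ_K` (i.e. `K(E[n]) = K`) iff `Γ_K` fixes every `n`-torsion point of `E(K̄)`.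
[folklore] -/
theorem ker_galoisRepTorsion_eq_top_iff (W : WeierstrassCurve K) (n : ℤ) :
    (W.galoisRepTorsion n).ker = ⊤ ↔
      ∀ (σ : Field.absoluteGaloisGroup K) (P : W.geomPoints), n • P = 0 → σ • P = P := by
  constructor
  · intro h σ
    have hσ : σ ∈ (W.galoisRepTorsion n).ker := by rw [h]; exact Subgroup.mem_top σ
    exact (mem_ker_galoisRepTorsion_iff' W n σ).mp hσ
  · intro h
    ext σ
    simp only [Subgroup.mem_top, iff_true]
    exact (mem_ker_galoisRepTorsion_iff' W n σ).mpr (h σ)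

/-- **`K(E'[n]) = K` passes along an injective isogeny `E → E'`**: if `λ : E → E'` is an
isogeny over `K` which is injective on `K̄`-points (an isomorphism onto its image) and `Γ_K` acts
trivially on `E'[n]`, then `Γ_K` acts trivially on `E[n]` (`λ` is `Γ_K`-equivariant and maps
`E[n]` into `E'[n]`). [folklore] -/
theorem ker_galoisRepTorsion_eq_top_of_injective {W W' : WeierstrassCurve K} (lam : Isogeny W W')
    (hinj : Function.Injective lam) (n : ℤ) (h : (W'.galoisRepTorsion n).ker = ⊤) :
    (W.galoisRepTorsion n).ker = ⊤ := by
  rw [ker_galoisRepTorsion_eq_top_iff] at h ⊢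
  intro σ P hP
  apply hinj
  rw [lam.map_smul]
  exact h σ (lam P) (by rw [← map_zsmul, hP, map_zero])

/-- The geometric point of `E(K̄)` underlying a rational affine point, with prescribed
coordinates (proof-irrelevance helper). [folklore] -/
theorem toGeomPoints_some_eq (W : WeierstrassCurve K) {x y : K} (h : W.toAffine.Nonsingular x y)
    {x' y' : AlgebraicClosure K}
    (h' : (W.baseChange (AlgebraicClosure K)).toAffine.Nonsingular x' y')
    (hx : algebraMap K (AlgebraicClosure K) x = x') (hy : algebraMap K (AlgebraicClosure K) y = y') :
    W.toGeomPoints (Affine.Point.some x y h) = (Affine.Point.some x' y' h' : W.geomPoints) := by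
  subst hx hy
  rfl

/-- The points of `E(K̄)` with `2P = O` on `E : y² = x(x - r)(x - s)` (`r, s ∈ K`) are `O`,
`(0, 0)`, `(r, 0)`, `(s, 0)`. Silverman, *AEC*, III.2.3, X.4.9. [folklore] -/
theorem geomPoints_eq_of_two_nsmul_eq_zero (W : WeierstrassCurve K) [W.IsTwoTorsionNF]
    (h2 : (2 : K) ≠ 0) {r s : K} (h₂ : W.a₂ = -(r + s)) (h₄ : W.a₄ = r * s) {P : W.geomPoints}
    (hP : (2 : ℕ) • P = 0) :
    P = 0 ∨ ∃ (x : AlgebraicClosure K)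
      (hx : (W.baseChange (AlgebraicClosure K)).toAffine.Nonsingular x 0),
      P = (Affine.Point.some x 0 hx : W.geomPoints) ∧
        (x = 0 ∨ x = algebraMap K (AlgebraicClosure K) r ∨ x = algebraMap K (AlgebraicClosure K) s) := by
  have h2L : (2 : AlgebraicClosure K) ≠ 0 := by
    intro h
    apply h2
    apply (algebraMap K (AlgebraicClosure K)).injective
    rw [map_ofNat, h, map_zero]
  exact eq_of_two_nsmul_eq_zero (W.baseChange (AlgebraicClosure K)) h2L
    (by rw [baseChange, map_a₂, h₂]; simp) (by rw [baseChange, map_a₄, h₄]; simp) hP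

/-- **`K(E[2]) = K` makes the `2`-torsion cubic split over `K`** (`K` perfect, `char K ≠ 2`): for
an elliptic `E : y² = x³ + ax² + bx` over `K` with `ker ρ̄_{E,2} = Γ_K`, the quadratic
`x² + ax + b` has its roots in `K`, i.e. `a = -(α + β)`, `b = αβ` with `α, β ∈ K`
(`E : y² = x(x - α)(x - β)`): a root `e ∈ K̄` gives the `2`-torsion point `(e, 0)`, fixed by
`Γ_K`, so `e ∈ K` (`K̄^{Γ_K} = K`, Mathlib `InfiniteGalois.mem_range_algebraMap_iff_fixed`).
Silverman, *AEC*, III.§7 and VIII.§1. [folklore] -/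
theorem exists_roots_of_ker_galoisRepTorsion_two_eq_top [PerfectField K] (W : WeierstrassCurve K)
    [W.IsTwoTorsionNF] [W.IsElliptic] (h2 : (2 : K) ≠ 0) (h : (W.galoisRepTorsion 2).ker = ⊤) :
    ∃ α β : K, W.a₂ = -(α + β) ∧ W.a₄ = α * β := by
  haveI : IsGalois K (AlgebraicClosure K) := {}
  have h2L : (2 : AlgebraicClosure K) ≠ 0 := by
    intro h'
    apply h2
    apply (algebraMap K (AlgebraicClosure K)).injective
    rw [map_ofNat, h', map_zero]
  -- a root `e` of `X² + aX + b` in `K̄`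
  set p : Polynomial (AlgebraicClosure K) := Polynomial.X ^ 2 +
    Polynomial.C (algebraMap K (AlgebraicClosure K) W.a₂) * Polynomial.X +
    Polynomial.C (algebraMap K (AlgebraicClosure K) W.a₄) with hp
  have hpdeg : p.degree = 2 := by
    rw [hp]
    compute_degree!
  obtain ⟨e, he⟩ : ∃ e, p.IsRoot e := IsAlgClosed.exists_root p (by rw [hpdeg]; decide)
  have he' : e ^ 2 + algebraMap K (AlgebraicClosure K) W.a₂ * e +
      algebraMap K (AlgebraicClosure K) W.a₄ = 0 := by
    simpa [hp] using he
  -- the `2`-torsion point `(e, 0)` of `E(K̄)`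
  have hns : (W.baseChange (AlgebraicClosure K)).toAffine.Nonsingular e 0 := by
    refine nonsingular_of_root (W.baseChange (AlgebraicClosure K)) ?_
    rw [baseChange, map_a₂, map_a₄]
    linear_combination e * he'
  set P : W.geomPoints := (Affine.Point.some e 0 hns : W.geomPoints) with hPdef
  have hP2 : (2 : ℤ) • P = 0 := by
    have h1 : (2 : ℕ) • (Affine.Point.some e 0 hns) = 0 :=
      (two_nsmul_some_eq_zero_iff (W.baseChange (AlgebraicClosure K)) h2L hns).mpr rfl
    exact_mod_cast h1
  -- `e` is fixed by `Γ_K`, hence in `K`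
  have hfix : ∀ σ : Field.absoluteGaloisGroup K,
      (show AlgebraicClosure K ≃ₐ[K] AlgebraicClosure K from σ) e = e := by
    intro σ
    have hσP : σ • P = P := (ker_galoisRepTorsion_eq_top_iff W 2).mp h σ P hP2
    obtain ⟨h', e'⟩ := smul_eq_some_of_eq' W σ hPdef
    rw [e', hPdef] at hσP
    exact ((Affine.Point.some.injEq _ _ _ _ _ _).mp hσP).1
  obtain ⟨α, hα⟩ := (InfiniteGalois.mem_range_algebraMap_iff_fixed e).mpr hfix
  refine ⟨α, -W.a₂ - α, by ring, ?_⟩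
  have hαroot : α ^ 2 + W.a₂ * α + W.a₄ = 0 := by
    apply (algebraMap K (AlgebraicClosure K)).injective
    rw [map_zero, ← he', ← hα]
    simp only [map_add, map_mul, map_pow]
  linear_combination hαroot

end FullTwoTorsion

/-! ## §C' Over `ℚ`: `#E(ℚ)[2] = 4` and Case V -/

section RatTwoTorsion

/-- **`#E(ℚ)[2] = 4 ⟹ ℚ(E[2]) = ℚ`**: if all four points of `E[2]` are `Γ_ℚ`-fixed then
`ker ρ̄_{E,2} = Γ_ℚ`. [folklore] -/
theorem ker_galoisRepTorsion_two_eq_top_of_ratTwoTorsionCard_eq_four (W : WeierstrassCurve ℚ)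
    [W.IsElliptic] (h : ratTwoTorsionCard W = 4) : (W.galoisRepTorsion 2).ker = ⊤ := by
  haveI : Finite (geomTorsion W (2 : ℤ)) :=
    Nat.finite_of_card_ne_zero (by rw [natCard_geomTorsion_two W]; decide)
  have huniv : MulAction.fixedPoints (Field.absoluteGaloisGroup ℚ) (geomTorsion W (2 : ℤ)) =
      Set.univ := by
    apply Set.eq_of_subset_of_ncard_le (Set.subset_univ _)
    rw [Set.ncard_univ, ← Nat.card_coe_set_eq, natCard_geomTorsion_two W]
    exact h.symm.le
  rw [ker_galoisRepTorsion_eq_top_iff]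
  intro σ P hP
  have hmem : (⟨P, (Submodule.mem_torsionBy_iff _ _).mpr hP⟩ : geomTorsion W (2 : ℤ)) ∈
      MulAction.fixedPoints (Field.absoluteGaloisGroup ℚ) (geomTorsion W (2 : ℤ)) := by
    rw [huniv]; exact Set.mem_univ _
  exact congrArg Subtype.val (hmem σ)

/-- **A curve in Smith's Case V has full rational `2`-torsion** (`#E(ℚ)[2] = 4`): it carries two
degree-`2` isogenies with different kernels, impossible for `#E(ℚ)[2] ∈ {1, 2}`.
[cite: arXiv250317619, Def. 1.6] -/
theorem ratTwoTorsionCard_eq_four_of_smithCaseV (W : WeierstrassCurve ℚ) [W.IsElliptic]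
    (hV : smithCaseV W) : ratTwoTorsionCard W = 4 := by
  obtain ⟨W₁, W₂, _, _, φ₁, φ₂, hb₁, hb₂, hne⟩ := hV
  rcases ratTwoTorsionCard_eq_one_or_two_or_four W with h1 | h2 | h4
  · exact absurd h1 (Isogeny.ratTwoTorsionCard_ne_one_of_degree_eq_two W φ₁ hb₁.1)
  · exact absurd (Isogeny.ker_eq_ker_of_degree_eq_two W h2 φ₁ φ₂ hb₁.1 hb₂.1) hne
  · exact h4

end RatTwoTorsion

/-! ## §D The explicit quotient of `y² = x³ + ax² + bx` by a rational point `(x₀, 0)` -/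

section Quotient

variable {K : Type u} [Field K]

/-- The shift `x ↦ x + x₀` by a root `x₀` of `x³ + ax² + bx` keeps two-torsion normal form
(`a₆' = x₀³ + ax₀² + bx₀ = 0`) and puts `(x₀, 0)` at `(0, 0)`. Silverman, *AEC*, III.1,
Table 3.1. [folklore] -/
theorem isTwoTorsionNF_smul_of_root (W : WeierstrassCurve K) [W.IsTwoTorsionNF] {x₀ : K}
    (hx₀ : x₀ ^ 3 + W.a₂ * x₀ ^ 2 + W.a₄ * x₀ = 0) :
    ((⟨1, x₀, 0, 0⟩ : VariableChange K) • W).IsTwoTorsionNF := by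
  refine ⟨?_, ?_, ?_⟩
  · simp [variableChange_a₁]
  · simp [variableChange_a₃]
  · simp only [variableChange_a₆, Units.val_one, inv_one, one_pow, one_mul, a₁_of_isTwoTorsionNF,
      a₃_of_isTwoTorsionNF, a₆_of_isTwoTorsionNF]
    linear_combination hx₀

/-- `a₂` of the shifted model: `a + 3x₀`. Silverman, *AEC*, III.1, Table 3.1. [folklore] -/
theorem smul_root_a₂ (W : WeierstrassCurve K) [W.IsTwoTorsionNF] (x₀ : K) :
    ((⟨1, x₀, 0, 0⟩ : VariableChange K) • W).a₂ = W.a₂ + 3 * x₀ := by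
  simp only [variableChange_a₂, Units.val_one, inv_one, one_pow, one_mul, a₁_of_isTwoTorsionNF]
  ring

/-- `a₄` of the shifted model: `b + 2ax₀ + 3x₀²`. Silverman, *AEC*, III.1, Table 3.1. [folklore] -/
theorem smul_root_a₄ (W : WeierstrassCurve K) [W.IsTwoTorsionNF] (x₀ : K) :
    ((⟨1, x₀, 0, 0⟩ : VariableChange K) • W).a₄ = W.a₄ + 2 * x₀ * W.a₂ + 3 * x₀ ^ 2 := by
  simp only [variableChange_a₄, Units.val_one, inv_one, one_pow, one_mul, a₁_of_isTwoTorsionNF,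
    a₃_of_isTwoTorsionNF]
  ring

/-- **Explicit quotient of `E : y² = x³ + ax² + bx` by the rational `2`-torsion point
`T = (x₀, 0)`** (`x₀` a root of `x³ + ax² + bx`, `E` elliptic): with the shift `C = (1, x₀, 0, 0)`
and `B := ` the codomain `Y² = X³ - 2a'X² + (a'² - 4b')X` of Silverman's `2`-isogeny of
`C • E : y² = x³ + a'x² + b'x` (`a' = a + 3x₀`, `b' = b + 2ax₀ + 3x₀²`), there are isogenies
`g : E → B`, `f : B → E` over `K` with `ker g = {O, T}`, `f g = [2]`, `g f = [2]`, and `B` is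
elliptic. (The tree's `exists_isogeny_ker_eq_pair` with the codomain made explicit.)
Silverman, *AEC*, III.4 Example 4.5, Prop. III.4.12, Thm. III.6.1–6.2.
[cite: SilvermanAEC2009, III.4 Example 4.5, Prop. III.4.12, Thm. III.6.1–6.2] -/
theorem exists_isogeny_twoIsogenyCodomain_smul (W : WeierstrassCurve K) [W.IsTwoTorsionNF]
    [W.IsElliptic] {x₀ : K} (hx₀ : x₀ ^ 3 + W.a₂ * x₀ ^ 2 + W.a₄ * x₀ = 0) :
    ∃ (_ : (((⟨1, x₀, 0, 0⟩ : VariableChange K) • W).twoIsogenyCodomain).IsElliptic)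
      (g : Isogeny W ((⟨1, x₀, 0, 0⟩ : VariableChange K) • W).twoIsogenyCodomain)
      (f : Isogeny ((⟨1, x₀, 0, 0⟩ : VariableChange K) • W).twoIsogenyCodomain W),
      (∀ Q, g Q = 0 ↔ Q = 0 ∨ Q = W.toGeomPoints (.some x₀ 0 (nonsingular_of_root W hx₀))) ∧
        (∀ P, f (g P) = 2 • P) ∧ ∀ Q, g (f Q) = 2 • Q := by
  set C : VariableChange K := ⟨1, x₀, 0, 0⟩ with hC
  haveI : (C • W).IsTwoTorsionNF := isTwoTorsionNF_smul_of_root W hx₀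
  obtain ⟨f₁, hf₁⟩ := exists_isogeny_twoIsogeny_comp_eq_two_nsmul (C • W)
  -- the isogenies
  let g : Isogeny W (C • W).twoIsogenyCodomain :=
    (C • W).twoIsogeny.comp (VariableChange.toIsogeny W C)
  let f : Isogeny (C • W).twoIsogenyCodomain W :=
    ((congrArg (Isogeny (C • W)) (inv_smul_smul C W)).mp
      (VariableChange.toIsogeny (C • W) C⁻¹)).comp f₁
  have hfg : ∀ P, f (g P) = 2 • P := fun P ↦ by
    show (congrArg (Isogeny (C • W)) (inv_smul_smul C W)).mp (VariableChange.toIsogeny (C • W) C⁻¹)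
      (f₁ ((C • W).twoIsogeny (VariableChange.toIsogeny W C P))) = 2 • P
    rw [hf₁, map_nsmul, VariableChange.cast_toIsogeny_inv_toIsogeny]
  -- `T ↦ (0, 0)`
  have hT : VariableChange.toIsogeny W C
      (W.toGeomPoints (Affine.Point.some x₀ 0 (nonsingular_of_root W hx₀))) =
      (C • W).geomTwoTorsionPoint := by
    obtain ⟨hns, e₀⟩ : ∃ hns, W.toGeomPoints (Affine.Point.some x₀ 0 (nonsingular_of_root W hx₀)) =
        Affine.Point.some (algebraMap K (AlgebraicClosure K) x₀)
          (algebraMap K (AlgebraicClosure K) 0) hns := ⟨_, rfl⟩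
    rw [e₀, VariableChange.toIsogeny_some]
    have hx : (C.map (algebraMap K (AlgebraicClosure K))).toX
        (algebraMap K (AlgebraicClosure K) x₀) = 0 := by
      simp [hC, VariableChange.toX_def, VariableChange.map]
    have hy : (C.map (algebraMap K (AlgebraicClosure K))).toY
        (algebraMap K (AlgebraicClosure K) x₀) (algebraMap K (AlgebraicClosure K) 0) = 0 := by
      simp [hC, VariableChange.toY_def, VariableChange.map]
    obtain ⟨h', e'⟩ := Literature.NumberTheory.EllipticCurves.UnivEC.some_eq_some_of_eq hx hy
      ((VariableChange.baseChange_smul_eq W C (AlgebraicClosure K)) ▸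
        (VariableChange.nonsingular_iff (W.baseChange (AlgebraicClosure K))
          (C.map (algebraMap K (AlgebraicClosure K))) _ _).mpr hns)
    exact e'
  refine ⟨inferInstance, g, f, fun Q ↦ ?_, hfg,
    Isogeny.comp_apply_eq_nsmul_of_comp_apply_eq_nsmul g f hfg⟩
  show (C • W).twoIsogeny (VariableChange.toIsogeny W C Q) = 0 ↔ _
  rw [twoIsogeny_apply, ← AddMonoidHom.mem_ker, mem_ker_twoIsogenyGeomHom_iff, ← hT,
    ← map_zero (VariableChange.toIsogeny W C), (VariableChange.toIsogeny_injective W C).eq_iff,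
    (VariableChange.toIsogeny_injective W C).eq_iff]

end Quotient

/-! ## §E Isogenies with the same kernel: factorisation through the explicit quotient -/

section Factor

variable {K : Type u} [Field K]

namespace Isogeny

/-- **An isogeny killing `ker g` factors through `g`** when `g : E → B` has a "dual" `f : B → E`
with `g ∘ f = [2]` (so `ker g ⊆ E[2]`): if `φ : E → E₁` kills `ker g` then `φ = λ ∘ g` for an
isogeny `λ : B → E₁` over `K` — namely `φ ∘ f` kills `B[2]`, hence `φ ∘ f = λ ∘ [2]`
(Silverman, *AEC*, Cor. III.4.11, tree `Isogeny.exists_eq_comp_zsmul_of_geomTorsion_le_ker`),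
and `λ ∘ g = φ` on `f(B(K̄)) = E(K̄)`. Silverman, *AEC*, Cor. III.4.11.
[cite: SilvermanAEC2009, Cor. III.4.11] -/
theorem exists_factor_of_ker_le {W B W₁ : WeierstrassCurve K} [W.IsElliptic] [B.IsElliptic]
    (h2 : (2 : K) ≠ 0) (g : Isogeny W B) (f : Isogeny B W) (hgf : ∀ Q, g (f Q) = 2 • Q)
    (φ : Isogeny W W₁) (hker : ∀ P, g P = 0 → φ P = 0) :
    ∃ lam : Isogeny B W₁, ∀ P, lam (g P) = φ P := by
  have h2K : ((2 : ℤ) : K) ≠ 0 := by exact_mod_cast h2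
  obtain ⟨lam, hlam⟩ := Isogeny.exists_eq_comp_zsmul_of_geomTorsion_le_ker h2K (φ.comp f)
    (fun Q hQ ↦ by
      rw [Isogeny.comp_apply]
      apply hker
      have hQ2 : (2 : ℤ) • Q = 0 := (Submodule.mem_torsionBy_iff _ _).mp hQ
      rw [hgf Q, ← hQ2, ← natCast_zsmul]
      rfl)
  refine ⟨lam, fun P ↦ ?_⟩
  obtain ⟨Q, rfl⟩ := f.surjective P
  have h1 := hlam Q
  rw [Isogeny.comp_apply] at h1
  rw [hgf Q, h1, ← natCast_zsmul]
  rfl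

/-- If moreover `ker φ ⊆ ker g`, the factor `λ` (`λ ∘ g = φ`) is injective on `K̄`-points.
[folklore] -/
theorem injective_of_factor {W B W₁ : WeierstrassCurve K} [W.IsElliptic] [B.IsElliptic]
    (g : Isogeny W B) (φ : Isogeny W W₁) (lam : Isogeny B W₁) (hlam : ∀ P, lam (g P) = φ P)
    (hker : ∀ P, φ P = 0 → g P = 0) : Function.Injective lam := by
  refine (injective_iff_map_eq_zero lam).mpr fun Q hQ ↦ ?_
  obtain ⟨P, rfl⟩ := g.surjective Q
  exact hker P (by rw [← hlam P]; exact hQ)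

/-- The factor `λ` (`λ ∘ g = φ`) is surjective on `K̄`-points (as `φ` is). [folklore] -/
theorem surjective_of_factor {W B W₁ : WeierstrassCurve K} [W.IsElliptic] [W₁.IsElliptic]
    (g : Isogeny W B) (φ : Isogeny W W₁) (lam : Isogeny B W₁) (hlam : ∀ P, lam (g P) = φ P) :
    Function.Surjective lam := fun R ↦ by
  obtain ⟨P, rfl⟩ := φ.surjective R
  exact ⟨g P, hlam P⟩

/-- **The kernel of a degree-`2` isogeny** is `{O, S}` with `S ≠ O`, `2S = O`. [folklore] -/
theorem exists_ker_eq_pair_of_degree_eq_two {W W₀ : WeierstrassCurve K} (φ : Isogeny W W₀)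
    (hφ : φ.degree = 2) :
    ∃ S : W.geomPoints, S ≠ 0 ∧ (2 : ℕ) • S = 0 ∧ ∀ Q, φ Q = 0 ↔ Q = 0 ∨ Q = S := by
  set K' := φ.toAddMonoidHom.ker with hK'_def
  have hK' : Nat.card K' = 2 := hφ
  obtain ⟨x, hx⟩ : ∃ x : K', x ≠ 0 := by
    by_contra h
    push Not at h
    haveI : Subsingleton K' := ⟨fun a b ↦ by rw [h a, h b]⟩
    have := Nat.card_of_subsingleton (0 : K')
    omega
  have hx0 : (x : W.geomPoints) ≠ 0 := fun e ↦ hx (Subtype.ext e)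
  have hx2 : (2 : ℕ) • (x : W.geomPoints) = 0 := by
    rw [← AddSubgroupClass.coe_nsmul, ← hK', card_nsmul_eq_zero', ZeroMemClass.coe_zero]
  refine ⟨x, hx0, hx2, fun Q ↦ ?_⟩
  have hmem : Q ∈ K' ↔ φ Q = 0 := by
    rw [hK'_def, AddMonoidHom.mem_ker, Isogeny.coe_toAddMonoidHom]
  rw [← hmem]
  constructor
  · intro hQ
    rcases eq_zero_or_eq_of_natCard_eq_two hK' hx ⟨Q, hQ⟩ with h0 | h1
    · exact Or.inl (congrArg Subtype.val h0)
    · exact Or.inr (congrArg Subtype.val h1)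
  · rintro (rfl | rfl)
    · exact zero_mem _
    · exact x.2

/-- Pulling a kernel `{O, S}` back along a bijective isogeny `λ`: `ker (ψ ∘ λ) = {O, λ⁻¹ S}`.
[folklore] -/
theorem exists_ker_comp_eq_pair {B W₁ W' : WeierstrassCurve K} (lam : Isogeny B W₁)
    (hbij : Function.Bijective lam) (ψ : Isogeny W₁ W') {S : W₁.geomPoints}
    (hS : ∀ Q, ψ Q = 0 ↔ Q = 0 ∨ Q = S) :
    ∃ S' : B.geomPoints, lam S' = S ∧ ∀ Q, ψ (lam Q) = 0 ↔ Q = 0 ∨ Q = S' := by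
  obtain ⟨S', rfl⟩ := hbij.2 S
  refine ⟨S', rfl, fun Q ↦ ?_⟩
  rw [hS, ← map_zero lam, hbij.1.eq_iff, hbij.1.eq_iff]

/-- **Pre-composing an isogeny with the inverse of a change of model of its source**: for
`φ : E → E₁` and a change of variables `C`, the isogeny `φ ∘ (C⁻¹) : C • E → E₁`
(Silverman, *AEC*, III.3.1(b); tree `VariableChange.cast_toIsogeny_inv_toIsogeny`). [folklore] -/
theorem exists_comp_toIsogeny {W W₁ : WeierstrassCurve K} (φ : Isogeny W W₁) (C : VariableChange K) :
    ∃ φ' : Isogeny (C • W) W₁, ∀ P, φ' (VariableChange.toIsogeny W C P) = φ P :=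
  ⟨φ.comp ((congrArg (Isogeny (C • W)) (inv_smul_smul C W)).mp
      (VariableChange.toIsogeny (C • W) C⁻¹)),
    fun P ↦ by rw [Isogeny.comp_apply, VariableChange.cast_toIsogeny_inv_toIsogeny]⟩

/-- The transported isogeny `φ' ∘ ι_C = φ` has the same degree (`ι_C` is bijective on
`K̄`-points). [folklore] -/
theorem degree_eq_of_comp_toIsogeny {W W₁ : WeierstrassCurve K} {φ : Isogeny W W₁}
    {C : VariableChange K} {φ' : Isogeny (C • W) W₁}
    (h : ∀ P, φ' (VariableChange.toIsogeny W C P) = φ P) : φ'.degree = φ.degree := by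
  unfold Isogeny.degree
  symm
  refine Nat.card_congr (Equiv.ofBijective
    (fun P : φ.toAddMonoidHom.ker ↦ (⟨VariableChange.toIsogeny W C P, by
      rw [AddMonoidHom.mem_ker, Isogeny.coe_toAddMonoidHom, h]
      exact P.2⟩ : φ'.toAddMonoidHom.ker)) ⟨?_, ?_⟩)
  · intro P Q hPQ
    exact Subtype.ext (VariableChange.toIsogeny_injective W C (congrArg Subtype.val hPQ))
  · rintro ⟨Q, hQ⟩
    obtain ⟨P, rfl⟩ := VariableChange.toIsogeny_surjective W C Q
    refine ⟨⟨P, ?_⟩, rfl⟩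
    rw [AddMonoidHom.mem_ker, Isogeny.coe_toAddMonoidHom, ← h]
    exact hQ

end Isogeny

/-- **`K(E[n]) = K` passes to a `K`-isomorphic model**: along a bijective isogeny `E → E'`
(e.g. a change of Weierstrass model) triviality of the `Γ_K`-action on `E[n]` transfers to
`E'[n]`. [folklore] -/
theorem ker_galoisRepTorsion_eq_top_of_bijective {W W' : WeierstrassCurve K} (lam : Isogeny W W')
    (hbij : Function.Bijective lam) (n : ℤ) (h : (W.galoisRepTorsion n).ker = ⊤) :
    (W'.galoisRepTorsion n).ker = ⊤ := by
  rw [ker_galoisRepTorsion_eq_top_iff] at h ⊢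
  intro σ P' hP'
  obtain ⟨P, rfl⟩ := hbij.2 P'
  have hP : n • P = 0 := hbij.1 (by rw [map_zsmul, hP', map_zero])
  rw [← lam.map_smul, h σ P hP]

end Factor

/-! ## §H The geometric core: `2`-quotients of `y² = x(x - r)(x - s)` with full `2`-torsion -/

section Core

variable {K : Type u} [Field K]

/-- **A `2`-quotient with full rational `2`-torsion forces a square.** Let
`E : y² = x³ + ax² + bx` be elliptic over a perfect field `K` (`char K ≠ 2`), `x₀ ∈ K` a root of
`x³ + ax² + bx` (so `T = (x₀, 0) ∈ E(K)[2]`), and `χ : E → E'` an isogeny over `K` with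
`ker χ = {O, T}` onto a curve with `K(E'[2]) = K`. Then `b + 2ax₀ + 3x₀²` is a square in `K`:
`χ` factors as an injective isogeny through the explicit quotient `E → B = E/⟨T⟩`
(`exists_isogeny_twoIsogenyCodomain_smul`, Silverman III.4.11–4.12), so `K(B[2]) = K`, and for
`B : Y² = X³ - 2a'X² + (a'² - 4b')X` (`a' = a + 3x₀`, `b' = b + 2ax₀ + 3x₀²`) this says that
`X² - 2a'X + (a'² - 4b')` splits over `K`, i.e. its discriminant `16b'` is a square.
Silverman, *AEC*, III.4 Example 4.5, X.4.9. [folklore] -/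
theorem isSquare_of_isogeny_ker_root [PerfectField K] (h2 : (2 : K) ≠ 0) (X : WeierstrassCurve K)
    [X.IsTwoTorsionNF] [X.IsElliptic] {x₀ : K} (hx₀ : x₀ ^ 3 + X.a₂ * x₀ ^ 2 + X.a₄ * x₀ = 0)
    {E' : WeierstrassCurve K} [E'.IsElliptic] (χ : Isogeny X E')
    (hχ : ∀ Q, χ Q = 0 ↔ Q = 0 ∨ Q = X.toGeomPoints (.some x₀ 0 (nonsingular_of_root X hx₀)))
    (hE' : (E'.galoisRepTorsion 2).ker = ⊤) :
    IsSquare (X.a₄ + 2 * x₀ * X.a₂ + 3 * x₀ ^ 2) := by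
  obtain ⟨hB, g, f, hgker, -, hgf⟩ := exists_isogeny_twoIsogenyCodomain_smul X hx₀
  haveI := hB
  obtain ⟨lam, hlam⟩ := Isogeny.exists_factor_of_ker_le h2 g f hgf χ
    (fun P hP ↦ (hχ P).mpr ((hgker P).mp hP))
  have hinj := Isogeny.injective_of_factor g χ lam hlam (fun P hP ↦ (hgker P).mpr ((hχ P).mp hP))
  have hB2 := ker_galoisRepTorsion_eq_top_of_injective lam hinj 2 hE'
  obtain ⟨α, β, hα, hβ⟩ := exists_roots_of_ker_galoisRepTorsion_two_eq_top _ h2 hB2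
  rw [twoIsogenyCodomain_a₂, smul_root_a₂] at hα
  rw [twoIsogenyCodomain_a₄, smul_root_a₂, smul_root_a₄] at hβ
  have h4 : (4 : K) ≠ 0 := by
    rw [show (4 : K) = 2 * 2 by norm_num]
    exact mul_ne_zero h2 h2
  have hid : (α - β) ^ 2 = (α + β) ^ 2 - 4 * (α * β) := by ring
  rw [← hβ, show α + β = 2 * (X.a₂ + 3 * x₀) by linear_combination hα] at hid
  refine (isSquare_mul_sq_iff h4 _).mp ⟨α - β, ?_⟩
  linear_combination -hid

/-- **A model adapted to a rational `2`-torsion point.** Let `E` be an elliptic curve over a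
perfect field `K` (`char K ≠ 2`) with `K(E[2]) = K`, and `S ∈ E(K̄)` a point of order `2`. Then
`S` is `K`-rational, and moving it to `(0, 0)` with `a₁ = a₃ = 0` (Silverman X.4.9,
`isTwoTorsionNF_smul_of_two_nsmul_eq_zero`) gives a model `C • E : y² = x(x - r)(x - s)` with
`r, s ∈ K` (the other two `2`-torsion points being rational as well) on which `S` is `(0, 0)`.
Silverman, *AEC*, III.1, VIII.§1, X.4.9. [folklore] -/
theorem exists_model_of_two_torsion [PerfectField K] (h2 : (2 : K) ≠ 0) (E : WeierstrassCurve K)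
    [E.IsElliptic] (hE : (E.galoisRepTorsion 2).ker = ⊤) {S : E.geomPoints} (hS0 : S ≠ 0)
    (hS2 : (2 : ℕ) • S = 0) :
    ∃ (C : VariableChange K) (_ : (C • E).IsTwoTorsionNF) (r s : K),
      (C • E).a₂ = -(r + s) ∧ (C • E).a₄ = r * s ∧
        VariableChange.toIsogeny E C S = (C • E).geomTwoTorsionPoint := by
  -- `S` is rational: `S = T₀ = (x₀, y₀) ∈ E(K)`
  have hfix : ∀ σ : Field.absoluteGaloisGroup K, σ • S = S := fun σ ↦
    (ker_galoisRepTorsion_eq_top_iff E 2).mp hE σ S (by exact_mod_cast hS2)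
  obtain ⟨T₀, hT₀⟩ := exists_toGeomPoints_eq_of_forall_smul_eq E hfix
  rcases T₀ with _ | ⟨x₀, y₀, h₀⟩
  · exact absurd (by rw [← hT₀]; rfl) hS0
  have h2T₀ : (2 : ℕ) • (Affine.Point.some x₀ y₀ h₀) = 0 := by
    apply toGeomPoints_injective E
    rw [map_nsmul, hT₀, hS2, map_zero]
  have hy₀ : y₀ = E.toAffine.negY x₀ y₀ := by
    by_contra hy
    apply Affine.Point.some_ne_zero (Affine.nonsingular_add h₀ h₀ fun hxy ↦ hy hxy.right)
    rw [← Affine.Point.add_self_of_Y_ne (h₁ := h₀) hy, ← two_nsmul, h2T₀]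
  -- the normal form
  set C : VariableChange K := ⟨1, x₀, -E.a₁ / 2, y₀⟩ with hC
  haveI hNF : (C • E).IsTwoTorsionNF := isTwoTorsionNF_smul_of_two_nsmul_eq_zero h2 h₀ hy₀
  -- `S ↦ (0, 0)`
  have hT : VariableChange.toIsogeny E C S = (C • E).geomTwoTorsionPoint := by
    rw [← hT₀]
    obtain ⟨hns, e₀⟩ : ∃ hns, E.toGeomPoints (Affine.Point.some x₀ y₀ h₀) =
        Affine.Point.some (algebraMap K (AlgebraicClosure K) x₀)
          (algebraMap K (AlgebraicClosure K) y₀) hns := ⟨_, rfl⟩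
    rw [e₀, VariableChange.toIsogeny_some]
    have hx : (C.map (algebraMap K (AlgebraicClosure K))).toX
        (algebraMap K (AlgebraicClosure K) x₀) = 0 := by
      simp [hC, VariableChange.toX_def, VariableChange.map]
    have hy : (C.map (algebraMap K (AlgebraicClosure K))).toY
        (algebraMap K (AlgebraicClosure K) x₀) (algebraMap K (AlgebraicClosure K) y₀) = 0 := by
      simp [hC, VariableChange.toY_def, VariableChange.map]
    obtain ⟨h', e'⟩ := Literature.NumberTheory.EllipticCurves.UnivEC.some_eq_some_of_eq hx hy
      ((VariableChange.baseChange_smul_eq E C (AlgebraicClosure K)) ▸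
        (VariableChange.nonsingular_iff (E.baseChange (AlgebraicClosure K))
          (C.map (algebraMap K (AlgebraicClosure K))) _ _).mpr hns)
    exact e'
  -- `K((C • E)[2]) = K`, so the `2`-torsion cubic of `C • E` splits over `K`
  have hCE : ((C • E).galoisRepTorsion 2).ker = ⊤ :=
    ker_galoisRepTorsion_eq_top_of_bijective (VariableChange.toIsogeny E C)
      ⟨VariableChange.toIsogeny_injective E C, VariableChange.toIsogeny_surjective E C⟩ 2 hE
  obtain ⟨r, s, hr, hs⟩ := exists_roots_of_ker_galoisRepTorsion_two_eq_top (C • E) h2 hCE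
  exact ⟨C, hNF, r, s, hr, hs, hT⟩

/-- A `2`-torsion point `(x, 0)` of `E(K̄)` with `x = 0` is the point `T = (0, 0)`. [folklore] -/
theorem some_eq_geomTwoTorsionPoint (W : WeierstrassCurve K) [W.IsTwoTorsionNF] [W.IsElliptic]
    {x : AlgebraicClosure K} (hx : (W.baseChange (AlgebraicClosure K)).toAffine.Nonsingular x 0)
    (h0 : x = 0) : (Affine.Point.some x 0 hx : W.geomPoints) = W.geomTwoTorsionPoint := by
  subst h0
  rfl

/-- A `2`-torsion point `(x, 0)` of `E(K̄)` with `x = r ∈ K`, `r` a root of `x³ + ax² + bx`, is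
the rational point `(r, 0)`. [folklore] -/
theorem some_eq_toGeomPoints_of_eq (W : WeierstrassCurve K) [W.IsTwoTorsionNF] [W.IsElliptic]
    {x : AlgebraicClosure K} (hx : (W.baseChange (AlgebraicClosure K)).toAffine.Nonsingular x 0)
    {r : K} (hr : r ^ 3 + W.a₂ * r ^ 2 + W.a₄ * r = 0)
    (h0 : x = algebraMap K (AlgebraicClosure K) r) :
    (Affine.Point.some x 0 hx : W.geomPoints) =
      W.toGeomPoints (.some r 0 (nonsingular_of_root W hr)) :=
  (toGeomPoints_some_eq W (nonsingular_of_root W hr) hx h0.symm (map_zero _)).symm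

/-- **Case V forces a square** (the second balanced kernel). Let `E : y² = x(x - r)(x - s)` be
elliptic over a perfect field `K` (`char K ≠ 2`), and `φ₂ : E → E₂` a degree-`2` isogeny over
`K` onto a curve with `K(E₂[2]) = K` whose kernel is **not** `{O, (0,0)}`. Then its kernel is
`{O, (r, 0)}` or `{O, (s, 0)}`, and accordingly `r(r - s)` or `s(s - r)` is a square in `K`
(`isSquare_of_isogeny_ker_root`: the quotient `E/⟨(r,0)⟩` has `b' = r(r - s)`). [folklore] -/
theorem isSquare_or_isSquare_of_second_kernel [PerfectField K] (h2 : (2 : K) ≠ 0)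
    (W : WeierstrassCurve K) [W.IsTwoTorsionNF] [W.IsElliptic] {r s : K} (h₂ : W.a₂ = -(r + s))
    (h₄ : W.a₄ = r * s) {W₂ : WeierstrassCurve K} [W₂.IsElliptic] (φ₂ : Isogeny W W₂)
    (hφ₂ : φ₂.degree = 2) (hW₂ : (W₂.galoisRepTorsion 2).ker = ⊤)
    (hne : ¬ ∀ Q, φ₂ Q = 0 ↔ Q = 0 ∨ Q = W.geomTwoTorsionPoint) :
    IsSquare (r * (r - s)) ∨ IsSquare (s * (s - r)) := by
  obtain ⟨T, hT0, hT2, hker⟩ := φ₂.exists_ker_eq_pair_of_degree_eq_two hφ₂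
  have hr : r ^ 3 + W.a₂ * r ^ 2 + W.a₄ * r = 0 := by rw [h₂, h₄]; ring
  have hs : s ^ 3 + W.a₂ * s ^ 2 + W.a₄ * s = 0 := by rw [h₂, h₄]; ring
  rcases geomPoints_eq_of_two_nsmul_eq_zero W h2 h₂ h₄ hT2 with h | ⟨x, hx, rfl, h0 | hxr | hxs⟩
  · exact absurd h hT0
  · exact absurd (fun Q ↦ (some_eq_geomTwoTorsionPoint W hx h0) ▸ hker Q) hne
  · left
    have key := isSquare_of_isogeny_ker_root h2 W hr φ₂
      (fun Q ↦ (some_eq_toGeomPoints_of_eq W hx hr hxr) ▸ hker Q) hW₂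
    have e : W.a₄ + 2 * r * W.a₂ + 3 * r ^ 2 = r * (r - s) := by rw [h₂, h₄]; ring
    rwa [e] at key
  · right
    have key := isSquare_of_isogeny_ker_root h2 W hs φ₂
      (fun Q ↦ (some_eq_toGeomPoints_of_eq W hx hs hxs) ▸ hker Q) hW₂
    have e : W.a₄ + 2 * s * W.a₂ + 3 * s ^ 2 = s * (s - r) := by rw [h₂, h₄]; ring
    rwa [e] at key

/-- **The geometric core of "Case V neighbours are Case IV".** Let `E : y² = x(x - r)(x - s)` be
elliptic over a perfect field `K` (`char K ≠ 2`), `φ : E → E₁` an isogeny over `K` with kernel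
`{O, (0, 0)}` onto a curve with `K(E₁[2]) = K`. Then there is a point `S₀ ∈ E₁(K̄)` (the image of
`E[2]`) such that every degree-`2` isogeny `ψ : E₁ → E'` over `K` onto a curve with `K(E'[2]) = K`
**either** has kernel `{O, S₀}` **or** produces `α, β ∈ K` with `α + β = -2(r + s)`,
`αβ = (r - s)²` and `α(α - β)` or `β(β - α)` a square. Proof: `E₁ ≅ B := E/⟨(0,0)⟩`, Silverman's
`Y² = X³ + 2(r + s)X² + (r - s)²X` (up to the `K`-isomorphism `λ` of
`Isogeny.exists_factor_of_ker_le`); `K(B[2]) = K` makes `B : Y² = X(X - α)(X - β)`; a degree-`2`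
kernel on `B` is `{O, (0,0)}` (giving `S₀ = λ(0,0)`), `{O, (α,0)}` or `{O, (β,0)}`, and in the
last two cases `isSquare_of_isogeny_ker_root` applies. Silverman, *AEC*, III.4.5, III.4.11–4.12,
X.4.9. [folklore] -/
theorem caseV_core [PerfectField K] (h2 : (2 : K) ≠ 0) (W : WeierstrassCurve K) [W.IsTwoTorsionNF]
    [W.IsElliptic] {r s : K} (h₂ : W.a₂ = -(r + s)) (h₄ : W.a₄ = r * s)
    {E₁ : WeierstrassCurve K} [E₁.IsElliptic] (φ : Isogeny W E₁)
    (hφ : ∀ Q, φ Q = 0 ↔ Q = 0 ∨ Q = W.geomTwoTorsionPoint) (hE₁ : (E₁.galoisRepTorsion 2).ker = ⊤) :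
    ∃ S₀ : E₁.geomPoints, ∀ {E' : WeierstrassCurve K} [E'.IsElliptic] (ψ : Isogeny E₁ E'),
      ψ.degree = 2 → (E'.galoisRepTorsion 2).ker = ⊤ →
        (∀ Q, ψ Q = 0 ↔ Q = 0 ∨ Q = S₀) ∨
        ∃ α β : K, α + β = -2 * (r + s) ∧ α * β = (r - s) ^ 2 ∧
          (IsSquare (α * (α - β)) ∨ IsSquare (β * (β - α))) := by
  -- `B = E/⟨(0,0)⟩` and `λ : B ≅ E₁`
  obtain ⟨f, hfg⟩ := exists_isogeny_twoIsogeny_comp_eq_two_nsmul W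
  have hgf := Isogeny.comp_apply_eq_nsmul_of_comp_apply_eq_nsmul W.twoIsogeny f hfg
  have hgker : ∀ Q, W.twoIsogeny Q = 0 ↔ Q = 0 ∨ Q = W.geomTwoTorsionPoint := fun Q ↦ by
    rw [twoIsogeny_apply, ← AddMonoidHom.mem_ker, mem_ker_twoIsogenyGeomHom_iff]
  obtain ⟨lam, hlam⟩ := Isogeny.exists_factor_of_ker_le h2 W.twoIsogeny f hgf φ
    (fun P hP ↦ (hφ P).mpr ((hgker P).mp hP))
  have hinj := Isogeny.injective_of_factor W.twoIsogeny φ lam hlam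
    (fun P hP ↦ (hgker P).mpr ((hφ P).mp hP))
  have hsurj := Isogeny.surjective_of_factor W.twoIsogeny φ lam hlam
  -- `B : Y² = X(X - α)(X - β)`
  have hB := ker_galoisRepTorsion_eq_top_of_injective lam hinj 2 hE₁
  obtain ⟨α, β, hα, hβ⟩ := exists_roots_of_ker_galoisRepTorsion_two_eq_top _ h2 hB
  have hsum : α + β = -2 * (r + s) := by
    rw [twoIsogenyCodomain_a₂, h₂] at hα
    linear_combination hα
  have hprod : α * β = (r - s) ^ 2 := by
    rw [twoIsogenyCodomain_a₄, h₂, h₄] at hβ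
    linear_combination -hβ
  have hαroot : α ^ 3 + W.twoIsogenyCodomain.a₂ * α ^ 2 + W.twoIsogenyCodomain.a₄ * α = 0 := by
    rw [hα, hβ]; ring
  have hβroot : β ^ 3 + W.twoIsogenyCodomain.a₂ * β ^ 2 + W.twoIsogenyCodomain.a₄ * β = 0 := by
    rw [hα, hβ]; ring
  refine ⟨lam W.twoIsogenyCodomain.geomTwoTorsionPoint, fun {E'} _ ψ hψ hE' ↦ ?_⟩
  -- the kernel of `ψ ∘ λ` is `{O, S'}`, `S' ∈ B[2]`
  obtain ⟨S, hS0, hS2, hSker⟩ := ψ.exists_ker_eq_pair_of_degree_eq_two hψ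
  obtain ⟨S', hS'S, hχ⟩ := Isogeny.exists_ker_comp_eq_pair lam ⟨hinj, hsurj⟩ ψ hSker
  have hS'2 : (2 : ℕ) • S' = 0 := hinj (by rw [map_nsmul, hS'S, hS2, map_zero])
  rcases geomPoints_eq_of_two_nsmul_eq_zero W.twoIsogenyCodomain h2 hα hβ hS'2 with
    h | ⟨x, hx, hS'x, h0 | hxα | hxβ⟩
  · exact absurd (by rw [← hS'S, h, map_zero]) hS0
  · -- kernel `{O, (0,0)_B}`: `ker ψ = {O, λ (0,0)}`
    left
    intro Q
    rw [hSker, ← hS'S, hS'x, some_eq_geomTwoTorsionPoint _ hx h0]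
  · -- kernel `{O, (α, 0)}`: `α(α - β)` is a square
    refine Or.inr ⟨α, β, hsum, hprod, Or.inl ?_⟩
    have key := isSquare_of_isogeny_ker_root h2 W.twoIsogenyCodomain hαroot (ψ.comp lam)
      (fun Q ↦ by
        rw [Isogeny.comp_apply, hχ Q, hS'x, some_eq_toGeomPoints_of_eq _ hx hαroot hxα]) hE'
    have e : W.twoIsogenyCodomain.a₄ + 2 * α * W.twoIsogenyCodomain.a₂ + 3 * α ^ 2 =
        α * (α - β) := by rw [hα, hβ]; ring
    rwa [e] at key
  · -- kernel `{O, (β, 0)}`: `β(β - α)` is a square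
    refine Or.inr ⟨α, β, hsum, hprod, Or.inr ?_⟩
    have key := isSquare_of_isogeny_ker_root h2 W.twoIsogenyCodomain hβroot (ψ.comp lam)
      (fun Q ↦ by
        rw [Isogeny.comp_apply, hχ Q, hS'x, some_eq_toGeomPoints_of_eq _ hx hβroot hxβ]) hE'
    have e : W.twoIsogenyCodomain.a₄ + 2 * β * W.twoIsogenyCodomain.a₂ + 3 * β ^ 2 =
        β * (β - α) := by rw [hα, hβ]; ring
    rwa [e] at key

end Core

/-! ## §H' Balanced isogenies and changes of model of the source (over `ℚ`) -/

section BalancedModel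

/-- **A balanced isogeny stays balanced after a change of model of the source**: if
`φ' ∘ ι_C = φ` with `ι_C : E ≅ C • E` then `deg φ' = deg φ` and `ℚ((C • E)[2]) = ℚ(E[2])`.
[cite: arXiv250317619, Def. 1.6] -/
theorem Isogeny.IsBalanced.of_comp_toIsogeny {W W₁ : WeierstrassCurve ℚ} {φ : Isogeny W W₁}
    (hφ : φ.IsBalanced) {C : VariableChange ℚ} {φ' : Isogeny (C • W) W₁}
    (h : ∀ P, φ' (VariableChange.toIsogeny W C P) = φ P) : φ'.IsBalanced :=
  ⟨(Isogeny.degree_eq_of_comp_toIsogeny h).trans hφ.1, (ker_galoisRepTorsion_smul W C 2).trans hφ.2⟩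

end BalancedModel

end WeierstrassCurve

/-! ## §I Smith's [Chil21] input: the balanced neighbours of a Case V curve are in Case IV -/

namespace Literature.NumberTheory.EllipticCurves

open WeierstrassCurve

/-- **The balanced neighbours of a Case V curve are in Case IV** — the input "[Chil21]" of
Smith's proof of Thm. 1.7 (arXiv:2503.17619, §1.2: *"by [Chil21] if `E` is in Case V, we find
that `E_0` is in Case IV"*; §3: *"`E` is in Case V only if it corresponds to the central node of
the final graph* [the `2`-isogeny graph `T₈` of Chiloyan–Lozano-Robledo] *and the other nodes of
degree `3` in this graph are in Case IV"*). Precisely: if `E/ℚ` is in Case V (Def. 1.6: two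
balanced isogenies with different kernels) and `φ : E → E₁` is a balanced isogeny, then `E₁` is in
Case IV: it has a balanced isogeny (the dual of `φ`), and all balanced isogenies on `E₁` have the
same kernel.

Proof (elementary, in place of the classification of [Chil21]): `E` has full rational
`2`-torsion (`ratTwoTorsionCard_eq_four_of_smithCaseV`), so `ℚ(E[2]) = ℚ = ℚ(E₁[2])` and balanced
isogenies out of `E`, `E₁` are exactly the degree-`2` isogenies onto curves with full rational
`2`-torsion. On the model `E : y² = x(x - r)(x - s)` adapted to `ker φ = {O, (0,0)}`
(`exists_model_of_two_torsion`), `E₁ ≅ E/⟨(0,0)⟩ : Y² = X(X - α)(X - β)` with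
`α + β = -2(r + s)`, `αβ = (r - s)²`; a balanced isogeny on `E₁` with kernel other than
`{O, (0,0)}` would make `α(α - β)` or `β(β - α)` a square (`caseV_core`), while the second
balanced kernel of `E` makes `r(r - s)` or `s(s - r)` a square
(`isSquare_or_isSquare_of_second_kernel`); with `t = (α - β)/4`, `q = t/r` this reads
`±q = □` and `±(1 - q²) = □`, i.e. a non-trivial rational point on `w² = v⁴ ∓ 1`, contradicting
Fermat's theorem `x⁴ - y⁴ ≠ z²` (`caseV_algebraic_core`, tree
`fermat_fourth_pow_sub_fourth_pow_ne_sq`). (Equivalently: the `2`-isogeny graph of a rational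
isogeny class contains no path of four curves with full rational `2`-torsion — the maximal
`2`-isogeny graph is `T₈` — which comes down to the rank-`0` curve `y² = x³ - x` / `X₀(32)`.)
(Chiloyan–Lozano-Robledo, Thm. 1.2 with the table of `T_k` graphs: the `2`-isogeny graphs of
rational isogeny classes are `T₄, T₆, T₈`; Fermat's theorem: Koshy (2001), Thm 13.3, the tree's
`fermat_fourth_pow_sub_fourth_pow_ne_sq`.)
[cite: arXiv250317619, §1.2 (proof of Thm. 1.7) and §3 (Figure 1 and the sentence after it);
ChiloyanLozanorobledo2021, Thm. 1.2 (isogeny graphs of type `T_k`)] -/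
theorem smithCaseIV_of_smithCaseV_of_isBalanced (E E₁ : WeierstrassCurve ℚ) [E.IsElliptic]
    [E₁.IsElliptic] (φ : Isogeny E E₁) (hV : smithCaseV E) (hφ : φ.IsBalanced) :
    smithCaseIV E₁ := by
  have h2 : (2 : ℚ) ≠ 0 := two_ne_zero
  have hE : (E.galoisRepTorsion 2).ker = ⊤ :=
    ker_galoisRepTorsion_two_eq_top_of_ratTwoTorsionCard_eq_four E
      (ratTwoTorsionCard_eq_four_of_smithCaseV E hV)
  have hE₁ : (E₁.galoisRepTorsion 2).ker = ⊤ := hφ.2.symm.trans hE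
  refine ⟨?_, fun X₁ X₂ _ _ ψ₁ ψ₂ hb₁ hb₂ ↦ ?_⟩
  · -- the dual of `φ` is a balanced isogeny on `E₁`
    obtain ⟨ψ, hψ⟩ := hφ.exists_comp_eq_two
    exact ⟨E, ‹_›, ψ, hφ.of_comp_eq_two ψ hψ⟩
  -- the kernel of `φ` and the adapted model `C • E : y² = x(x - r)(x - s)`
  obtain ⟨S, hS0, hS2, hSker⟩ := φ.exists_ker_eq_pair_of_degree_eq_two hφ.1
  obtain ⟨C, hNF, r, s, h₂, h₄, hCS⟩ := exists_model_of_two_torsion h2 E hE hS0 hS2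
  haveI := hNF
  have hrs0 : r * s ≠ 0 := h₄ ▸ a₄_ne_zero (C • E)
  have hr : r ≠ 0 := left_ne_zero_of_mul hrs0
  have hs : s ≠ 0 := right_ne_zero_of_mul hrs0
  have hrs : r ≠ s := by
    intro e
    apply a₂_sq_sub_ne_zero (C • E)
    rw [h₂, h₄, e]
    ring
  -- `φ` on the adapted model
  obtain ⟨φ', hφ'⟩ := φ.exists_comp_toIsogeny C
  have hφ'ker : ∀ Q, φ' Q = 0 ↔ Q = 0 ∨ Q = (C • E).geomTwoTorsionPoint := by
    intro Q
    obtain ⟨P, rfl⟩ := VariableChange.toIsogeny_surjective E C Q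
    rw [hφ', hSker, ← hCS, ← map_zero (VariableChange.toIsogeny E C),
      (VariableChange.toIsogeny_injective E C).eq_iff, (VariableChange.toIsogeny_injective E C).eq_iff]
  -- Case V: a balanced isogeny on `E` with another kernel, on the adapted model
  obtain ⟨W₀, hW₀, φ₀, hb₀, hne₀⟩ : ∃ (W₀ : WeierstrassCurve ℚ) (_ : W₀.IsElliptic)
      (φ₀ : Isogeny E W₀), φ₀.IsBalanced ∧ φ₀.toAddMonoidHom.ker ≠ φ.toAddMonoidHom.ker := by
    obtain ⟨W₁, W₂, _, _, φ₁, φ₂, hb₁', hb₂', hne⟩ := hV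
    by_cases h : φ₁.toAddMonoidHom.ker = φ.toAddMonoidHom.ker
    · exact ⟨W₂, ‹_›, φ₂, hb₂', fun h' ↦ hne (h.trans h'.symm)⟩
    · exact ⟨W₁, ‹_›, φ₁, hb₁', h⟩
  haveI := hW₀
  obtain ⟨φ₀', hφ₀'⟩ := φ₀.exists_comp_toIsogeny C
  have hb₀' : φ₀'.IsBalanced := hb₀.of_comp_toIsogeny hφ₀'
  have hW₀2 : (W₀.galoisRepTorsion 2).ker = ⊤ := hb₀.2.symm.trans hE
  have hne₀' : ¬ ∀ Q, φ₀' Q = 0 ↔ Q = 0 ∨ Q = (C • E).geomTwoTorsionPoint := by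
    intro hall
    apply hne₀
    ext P
    rw [AddMonoidHom.mem_ker, AddMonoidHom.mem_ker, Isogeny.coe_toAddMonoidHom,
      Isogeny.coe_toAddMonoidHom, ← hφ₀', hall, ← hφ'ker, hφ']
  have hV' := isSquare_or_isSquare_of_second_kernel h2 (C • E) h₂ h₄ φ₀' hb₀'.1 hW₀2 hne₀'
  -- the core, and Fermat
  obtain ⟨S₀, hcore⟩ := caseV_core h2 (C • E) h₂ h₄ φ' hφ'ker hE₁
  have hk : ∀ {X : WeierstrassCurve ℚ} [X.IsElliptic] (ψ : Isogeny E₁ X), ψ.IsBalanced →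
      ∀ Q, ψ Q = 0 ↔ Q = 0 ∨ Q = S₀ := by
    intro X _ ψ hb
    rcases hcore ψ hb.1 (hb.2.symm.trans hE₁) with h | ⟨α, β, hsum, hprod, hS⟩
    · exact h
    · exact (caseV_algebraic_core hr hs hrs hsum hprod hV' hS).elim
  ext Q
  rw [AddMonoidHom.mem_ker, AddMonoidHom.mem_ker, Isogeny.coe_toAddMonoidHom,
    Isogeny.coe_toAddMonoidHom, hk ψ₁ hb₁, hk ψ₂ hb₂]

/-- **No two Case V curves are joined by a balanced isogeny** (Cases IV and V are disjoint).
[cite: arXiv250317619, §3 (Figure 1 and the sentence after it); ChiloyanLozanorobledo2021, Thm. 1.2] -/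
theorem not_smithCaseV_of_isBalanced (E E₁ : WeierstrassCurve ℚ) [E.IsElliptic] [E₁.IsElliptic]
    (φ : Isogeny E E₁) (hV : smithCaseV E) (hφ : φ.IsBalanced) : ¬ smithCaseV E₁ :=
  not_smithCaseV_of_smithCaseIV (smithCaseIV_of_smithCaseV_of_isBalanced E E₁ φ hV hφ)

open Literature.NumberTheory.EllipticCurves.ModularForms in
/-- **Smith's Theorem 1.1 for every elliptic curve over `ℚ` from its printed inputs, with the
[Chil21] input now proved** (`smithCaseIV_of_smithCaseV_of_isBalanced`): the assembly
`smith_selmerCorank_density_of_printed_inputs` (`BSDSelmerSmithCasesProofs`) with its hypothesis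
`hChil` discharged. Remaining hypotheses, all for models with `a₁ = a₃ = 0`: `hSmi` — Thm. 1.1
for curves in Cases I and II ([Smi22a]); `h17IV`, `h17V` — the two printed conclusions of
Thm. 1.17; and the tree facts `exists_isNewformOf` (Modularity) and
`monsky_selmerCorank_two_mod_two_eq` (`2`-parity) for the parity half.
[cite: arXiv250317619, Thm. 1.1 (proof, §1.1) and Thm. 1.7 (proof, §1.2)] -/
theorem smith_selmerCorank_density_of_printed_inputs'
    (hmod : exists_isNewformOf) (hMon : monsky_selmerCorank_two_mod_two_eq)
    (hSmi : ∀ (E : WeierstrassCurve ℚ) [E.IsElliptic] [E.IsCharNeTwoNF],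
      smithCaseI E ∨ smithCaseII E → smith_selmerCorank_density E)
    (h17IV : ∀ (E E₀ : WeierstrassCurve ℚ) [E.IsElliptic] [E₀.IsElliptic] [E.IsCharNeTwoNF]
      [E₀.IsCharNeTwoNF] (φ : Isogeny E E₀) (φ' : Isogeny E₀ E),
      smithCaseIV E → φ.IsBalanced → (∀ P, φ' (φ P) = (2 : ℤ) • P) →
        twistDensity (fun d ↦ d ≠ 0 ∧
          (selmerCorankTwoInfty (E.quadraticTwist d) ≤ 1 ∨
            (selmerCorankTwoInfty (E.quadraticTwist d) = φ.twistDivRank d ∧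
              2 ≤ φ.twistDivRank d))) 1)
    (h17V : ∀ (E E₁ E₂ : WeierstrassCurve ℚ) [E.IsElliptic] [E₁.IsElliptic] [E₂.IsElliptic]
      [E.IsCharNeTwoNF] [E₁.IsCharNeTwoNF] [E₂.IsCharNeTwoNF] (φ₁ : Isogeny E E₁)
      (φ₂ : Isogeny E E₂),
      smithCaseV E → φ₁.IsBalanced → φ₂.IsBalanced →
        φ₁.toAddMonoidHom.ker ≠ φ₂.toAddMonoidHom.ker →
        twistDensity (fun d ↦ d ≠ 0 ∧
          (selmerCorankTwoInfty (E.quadraticTwist d) ≤ 1 ∨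
            (selmerCorankTwoInfty (E.quadraticTwist d) = φ₁.twistDivRank d ∧
              2 ≤ φ₁.twistDivRank d) ∨
            (selmerCorankTwoInfty (E.quadraticTwist d) = φ₂.twistDivRank d ∧
              2 ≤ φ₂.twistDivRank d))) 1)
    (E : WeierstrassCurve ℚ) [E.IsElliptic] : smith_selmerCorank_density E :=
  smith_selmerCorank_density_of_printed_inputs hmod hMon hSmi h17IV h17V
    (fun E E₁ _ _ φ hV hb ↦ smithCaseIV_of_smithCaseV_of_isBalanced E E₁ φ hV hb) E

end Literature.NumberTheory.EllipticCurves

end
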